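import Mathlib
import Literature.NumberTheory.LFunctions.CharacterHarmonicTails
import Summits.ValiantsHypothesis.ValiantsHypothesis.Theorems.FeketeSOSCharPSparseSOSSidonHarmonicMass

/-!
# Crux `FeketeSOS.CharPSparseSOS` (stmt-ValiantsHypothesis-14989) — ordered analogue of (CORE), part 1:
Pólya–Vinogradov for the Legendre symbol and the quantitative harmonic-mass inequality

Tools for `orderedCoreSumClique` (`FeketeSOSCharPSparseSOSOrderedCore.lean`): the Legendre symbol mod an odd prime as a
primitive Dirichlet character (`oc_exists_dirichletCharacter_legendreSym`), the real and harmonic Pólya–Vinogradov windows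
`|Σ_{N<n≤M} (n|p)| ≤ √p(1 + log p)` and `|Σ_{N<n≤M} (n|p)/n| ≤ √p(1 + log p)/(N+1)` (from the tree's
`Literature.NumberTheory.Sieve.LargeSieve.polyaVinogradov` via `CharacterTails.norm_window_le_polyaVinogradov` and the
finite Abel bound `CharacterTails.norm_sum_Ioc_mul_le_of_window`), the crude counting bound `q² − q ≤ 2(p − 1)`
(`oc_counting`), and the registered sub-goal `orderedCore_quantitative`: for an odd prime `p`, `W := √p (1 + log p)`,
`1 ≤ L ≤ p`, and a weak-Sidon `Q ⊆ ℕ` with restricted integer pair sums in `[1, p)` that are QRs mod `p`, `q = |Q| ≥ 1`,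
`4q ≤ L`:
`½·log(p/L) − W/(2L) − ((p−1)/2 + W/2 − q(q−1)/2)/L ≤ 5π`
(Sidon harmonic mass `sidonHarmonicMass`, p154307, against the harmonic mass of `QR ∩ [L, p)`).

Lead c7 of the crux; `--supports stmt-ValiantsHypothesis-14989`.  Calibration of the ordered door (p152605) only.
-/

-- `Summit.ValiantsHypothesis.ValiantsHypothesis.…` is the tree's mandated single-conjunct layout (Sub = Summit).
set_option linter.dupNamespace false

namespace Summit.ValiantsHypothesis.ValiantsHypothesis.Theorems.CharPSparseSOSTwoCusp

open Finset
open Literature.NumberTheory.LFunctions.CharacterTails (norm_window_le_polyaVinogradov norm_sum_Ioc_mul_le_of_window)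

/-- The Legendre symbol modulo an odd prime `p` is (the restriction to `ℕ` of) a primitive Dirichlet character
of level `p` with values in `ℂ`. [folklore] -/
theorem oc_exists_dirichletCharacter_legendreSym (p : ℕ) [Fact p.Prime] (hp2 : p ≠ 2) :
    ∃ χ : DirichletCharacter ℂ p, χ.IsPrimitive ∧ ∀ n : ℕ, χ (n : ZMod p) = ((legendreSym p n : ℤ) : ℂ) := by
  have hp : p.Prime := Fact.out
  set χ : DirichletCharacter ℂ p := (quadraticChar (ZMod p)).ringHomComp (Int.castRingHom ℂ) with hχdef
  refine ⟨χ, ?_, ?_⟩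
  · -- non-trivial, hence primitive (the level is prime)
    have hne : χ ≠ 1 := by
      intro h1
      have hchar : ringChar (ZMod p) ≠ 2 := by
        rw [ZMod.ringChar_zmod_n]; exact hp2
      obtain ⟨a, ha⟩ := quadraticChar_exists_neg_one' hchar
      have h2 := congrArg (fun ψ : DirichletCharacter ℂ p => ψ (a : ZMod p)) h1
      simp only [hχdef, MulChar.ringHomComp_apply, ha, MulChar.one_apply_coe] at h2
      norm_num at h2
    have hNZ : NeZero p := ⟨hp.ne_zero⟩
    have hcond : DirichletCharacter.conductor χ ≠ 1 := by
      intro h; exact hne (DirichletCharacter.eq_one_iff_conductor_eq_one.2 h)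
    have hdvd := DirichletCharacter.conductor_dvd_level χ
    rcases (Nat.dvd_prime hp).1 hdvd with h | h
    · exact absurd h hcond
    · exact h
  · intro n
    simp only [hχdef, MulChar.ringHomComp_apply, legendreSym, Int.cast_natCast, eq_intCast]

/-- **Pólya–Vinogradov for the Legendre symbol, real window form**: for an odd prime `p` and all `N ≤ M`,
`|Σ_{N < n ≤ M} (n | p)| ≤ √p (1 + log p)`. [cite: MontgomeryVaughan2007, §9.4 Thm. 9.18] -/
theorem oc_abs_sum_legendreSym_Ioc_le (p : ℕ) [Fact p.Prime] (hp2 : p ≠ 2) (N M : ℕ) :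
    |∑ n ∈ Ioc N M, ((legendreSym p n : ℤ) : ℝ)| ≤ Real.sqrt p * (1 + Real.log p) := by
  have hp : p.Prime := Fact.out
  obtain ⟨χ, hχ, hval⟩ := oc_exists_dirichletCharacter_legendreSym p hp2
  have h := norm_window_le_polyaVinogradov χ hχ hp.two_le N M
  have hcast : (∑ n ∈ Ioc N M, χ (n : ZMod p)) = ((∑ n ∈ Ioc N M, ((legendreSym p n : ℤ) : ℝ) : ℝ) : ℂ) := by
    push_cast
    exact sum_congr rfl fun n _ => by rw [hval n]
  rw [hcast, Complex.norm_real, Real.norm_eq_abs] at h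
  exact h

/-- **Harmonic window form**: for an odd prime `p` and `N`, `M`:
`|Σ_{N < n ≤ M} (n | p)/n| ≤ √p (1 + log p)/(N + 1)` (finite Abel summation). [folklore] -/
theorem oc_abs_sum_legendreSym_div_Ioc_le (p : ℕ) [Fact p.Prime] (hp2 : p ≠ 2) (N M : ℕ) :
    |∑ n ∈ Ioc N M, ((legendreSym p n : ℤ) : ℝ) / n| ≤ Real.sqrt p * (1 + Real.log p) / ((N : ℝ) + 1) := by
  have hp : p.Prime := Fact.out
  obtain ⟨χ, hχ, hval⟩ := oc_exists_dirichletCharacter_legendreSym p hp2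
  have hS : ∀ n, ‖∑ k ∈ Ioc N n, χ (k : ZMod p)‖ ≤ Real.sqrt p * (1 + Real.log p) :=
    fun n => norm_window_le_polyaVinogradov χ hχ hp.two_le N n
  have h := norm_sum_Ioc_mul_le_of_window χ hS (a := fun n => 1 / (n : ℝ))
    (fun n _ => by positivity)
    (fun n hn => by
      apply one_div_le_one_div_of_le
      · exact_mod_cast (show 0 < n by omega)
      · push_cast
        linarith) M
  have hcast : (∑ n ∈ Ioc N M, χ (n : ZMod p) * (((1 : ℝ) / (n : ℝ) : ℝ) : ℂ)) =
      ((∑ n ∈ Ioc N M, ((legendreSym p n : ℤ) : ℝ) / n : ℝ) : ℂ) := by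
    push_cast
    refine sum_congr rfl fun n _ => ?_
    rw [hval n]; ring
  rw [hcast, Complex.norm_real, Real.norm_eq_abs] at h
  simp only [Nat.cast_add, Nat.cast_one] at h
  rw [mul_one_div] at h
  exact h




/-- Values of the Legendre symbol on `[1, p)`: `±1`. [folklore] -/
theorem oc_legendreSym_eq_one_or_neg_one (p : ℕ) [Fact p.Prime] {n : ℕ} (hn : n ∈ Ico 1 p) :
    legendreSym p n = 1 ∨ legendreSym p n = -1 := by
  rw [mem_Ico] at hn
  apply legendreSym.eq_one_or_neg_one
  intro h
  have h' : ((n : ℕ) : ZMod p) = 0 := by exact_mod_cast h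
  rw [ZMod.natCast_eq_zero_iff] at h'
  exact absurd (Nat.le_of_dvd (by omega) h') (by omega)


/-- Crude counting: the `q(q−1)/2` restricted pair sums of `Q` are pairwise distinct (weak Sidon) elements of `[1, p)`,
so `q² − q ≤ 2(p − 1)`. [folklore] -/
theorem oc_counting (p : ℕ) [Fact p.Prime] (Q : Finset ℕ)
    (hsum : ∀ a ∈ Q, ∀ b ∈ Q, a < b → a + b < p ∧ legendreSym p (a + b) = 1)
    (hws : ∀ a ∈ Q, ∀ b ∈ Q, ∀ c ∈ Q, ∀ d ∈ Q, a ≠ b → c ≠ d → a + b = c + d →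
      (a = c ∧ b = d) ∨ (a = d ∧ b = c)) :
    (Q.card : ℝ) ^ 2 - Q.card ≤ 2 * ((p : ℝ) - 1) := by
  have hp : p.Prime := Fact.out
  set T₀ := (Q ×ˢ Q).filter (fun x : ℕ × ℕ => x.1 < x.2) with hT₀
  have hinj : Set.InjOn (fun x : ℕ × ℕ => x.1 + x.2) (T₀ : Set (ℕ × ℕ)) := by
    intro x hx y hy hxy
    simp only [coe_filter, hT₀, Set.mem_setOf_eq, mem_product] at hx hy
    rcases hws x.1 hx.1.1 x.2 hx.1.2 y.1 hy.1.1 y.2 hy.1.2 (by omega) (by omega) hxy with ⟨h1, h2⟩ | ⟨h1, h2⟩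
    · exact Prod.ext h1 h2
    · omega
  have hT₀card : 2 * (T₀.card : ℝ) + Q.card = (Q.card : ℝ) ^ 2 := by
    have h := qrp_sum_product_split Q (fun _ => (1 : ℝ))
    simp only [sum_const, nsmul_eq_mul, mul_one, card_product, Nat.cast_mul] at h
    rw [← hT₀] at h
    nlinarith [h]
  have himg : T₀.image (fun x : ℕ × ℕ => x.1 + x.2) ⊆ Ico 1 p := by
    intro n hn
    rw [mem_image] at hn
    obtain ⟨x, hx, rfl⟩ := hn
    simp only [hT₀, mem_filter, mem_product] at hx
    obtain ⟨⟨ha, hb⟩, hab⟩ := hx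
    exact mem_Ico.2 ⟨by omega, (hsum x.1 ha x.2 hb hab).1⟩
  have hcard : T₀.card ≤ p - 1 := by
    rw [← card_image_of_injOn hinj]
    exact (card_le_card himg).trans (by rw [Nat.card_Ico])
  have hcardR : (T₀.card : ℝ) ≤ (p : ℝ) - 1 := by
    have : ((T₀.card : ℕ) : ℝ) ≤ ((p - 1 : ℕ) : ℝ) := by exact_mod_cast hcard
    rw [Nat.cast_sub hp.one_lt.le] at this; push_cast at this; exact this
  nlinarith [hT₀card, hcardR]


/-- **The quantitative core.**  Let `p` be an odd prime, `W := √p (1 + log p)`, `1 ≤ L ≤ p`, and let `Q ⊆ ℕ` be weak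
Sidon with all restricted pair sums in `[1, p)` and quadratic residues mod `p`, `q := |Q| ≥ 1`, `4q ≤ L`.  Then
`(1/2)·log(p/L) − W/(2L) − ((p−1)/2 + W/2 − q(q−1)/2)/L ≤ 5π`.
Proof: the harmonic mass `U` of the pairs with `a + b ≥ L` is `≤ (π/(2q))(5q)·2 = 5π` by `sidonHarmonicMass`; on the other
hand the sums are distinct QRs, so `U = Σ_{n ∈ P} 1/n` for a set `P ⊆ QR ∩ [L, p)` with
`#(QR ∩ [L,p)) − #P ≤ #(QR ∩ [1,p)) − C(q,2) ≤ (p−1)/2 + W/2 − q(q−1)/2` (pairs with `a + b < L` inject into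
`QR ∩ [1, L)`; `#(QR ∩ [1,p)) = (p−1)/2 + ½Σ_{n<p} (n|p) ≤ (p−1)/2 + W/2`), each missing `n ≥ L` costing `≤ 1/L`, while
`Σ_{n ∈ QR ∩ [L,p)} 1/n = ½Σ_{L≤n<p} 1/n + ½Σ_{L≤n<p} (n|p)/n ≥ ½ log(p/L) − W/(2L)` (integral test and the harmonic
Pólya–Vinogradov window). -/
theorem orderedCore_quantitative : ∀ (p : ℕ) [Fact p.Prime], p ≠ 2 → ∀ (Q : Finset ℕ) (L : ℕ), 1 ≤ L → L ≤ p → (∀ a ∈ Q, ∀ b ∈ Q, a < b → a + b < p ∧ legendreSym p (a + b) = 1) → (∀ a ∈ Q, ∀ b ∈ Q, ∀ c ∈ Q, ∀ d ∈ Q, a ≠ b → c ≠ d → a + b = c + d → (a = c ∧ b = d) ∨ (a = d ∧ b = c)) → 1 ≤ Q.card → 4 * Q.card ≤ L → (1 / 2 : ℝ) * Real.log ((p : ℝ) / L) - Real.sqrt p * (1 + Real.log p) / (2 * L) - (((p : ℝ) - 1) / 2 + Real.sqrt p * (1 + Real.log p) / 2 - (Q.card : ℝ) * ((Q.card : ℝ)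 - 1) / 2) / L ≤ 5 * Real.pi := by
  intro p inst hp2 Q L hL1 hLp hsum hws hq1 h4q
  have hp : p.Prime := Fact.out
  set W : ℝ := Real.sqrt p * (1 + Real.log p) with hW
  set q : ℕ := Q.card with hq
  set ℓ : ℕ → ℝ := fun n => ((legendreSym p n : ℤ) : ℝ) with hℓ
  set ρ : ℕ → ℝ := fun n => (1 + ℓ n) / 2 with hρ
  have hL0 : (0 : ℝ) < L := by exact_mod_cast (show 0 < L by omega)
  have hlog0 : 0 ≤ Real.log p := Real.log_natCast_nonneg p
  have hW0 : 0 ≤ W := by positivity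
  -- values of ρ on [1, p)
  have hρ01 : ∀ n ∈ Ico 1 p, 0 ≤ ρ n ∧ ρ n ≤ 1 := by
    intro n hn
    rcases oc_legendreSym_eq_one_or_neg_one p hn with h | h
    · simp only [hρ, hℓ, h]; norm_num
    · simp only [hρ, hℓ, h]; norm_num
  have hρone : ∀ n ∈ Ico 1 p, legendreSym p n = 1 → ρ n = 1 := by
    intro n _ h; simp only [hρ, hℓ, h]; norm_num
  -- the pair sets
  set T₀ := (Q ×ˢ Q).filter (fun x : ℕ × ℕ => x.1 < x.2) with hT₀
  set T := (Q ×ˢ Q).filter (fun x : ℕ × ℕ => x.1 < x.2 ∧ L ≤ x.1 + x.2) with hT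
  set T' := (Q ×ˢ Q).filter (fun x : ℕ × ℕ => x.1 < x.2 ∧ x.1 + x.2 < L) with hT'
  -- injectivity of the sum map on pairs `a < b` (weak Sidon)
  have hinj : Set.InjOn (fun x : ℕ × ℕ => x.1 + x.2) (T₀ : Set (ℕ × ℕ)) := by
    intro x hx y hy hxy
    simp only [coe_filter, hT₀, Set.mem_setOf_eq, mem_product] at hx hy
    rcases hws x.1 hx.1.1 x.2 hx.1.2 y.1 hy.1.1 y.2 hy.1.2 (by omega) (by omega) hxy with ⟨h1, h2⟩ | ⟨h1, h2⟩
    · exact Prod.ext h1 h2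
    · omega
  have hTsub : T ⊆ T₀ := by
    intro x hx; simp only [hT, hT₀, mem_filter] at hx ⊢; exact ⟨hx.1, hx.2.1⟩
  have hT'sub : T' ⊆ T₀ := by
    intro x hx; simp only [hT', hT₀, mem_filter] at hx ⊢; exact ⟨hx.1, hx.2.1⟩
  -- #T₀ = q(q-1)/2 (as reals: 2 #T₀ + q = q²)
  have hT₀card : 2 * (T₀.card : ℝ) + q = (q : ℝ) ^ 2 := by
    have h := qrp_sum_product_split Q (fun _ => (1 : ℝ))
    simp only [sum_const, nsmul_eq_mul, mul_one, card_product, Nat.cast_mul] at h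
    rw [← hT₀] at h
    rw [hq]; nlinarith [h]
  -- #T₀ = #T + #T'
  have hTT' : (T₀.card : ℝ) = T.card + T'.card := by
    have hdisj : Disjoint T T' := by
      rw [disjoint_filter]; intro x _ h1 h2; omega
    have hunion : T ∪ T' = T₀ := by
      ext x; simp only [hT, hT', hT₀, mem_union, mem_filter]
      constructor
      · rintro (⟨h1, h2, -⟩ | ⟨h1, h2, -⟩) <;> exact ⟨h1, h2⟩
      · rintro ⟨h1, h2⟩
        by_cases h : L ≤ x.1 + x.2
        · exact Or.inl ⟨h1, h2, h⟩
        · exact Or.inr ⟨h1, h2, by omega⟩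
    rw [← hunion, card_union_of_disjoint hdisj]; push_cast; ring
  -- #T' ≤ Σ_{n ∈ Ico 1 L} ρ n
  have hT'le : (T'.card : ℝ) ≤ ∑ n ∈ Ico 1 L, ρ n := by
    have himg : T'.image (fun x : ℕ × ℕ => x.1 + x.2) ⊆ (Ico 1 L).filter (fun n : ℕ => legendreSym p n = 1) := by
      intro n hn
      rw [mem_image] at hn
      obtain ⟨x, hx, rfl⟩ := hn
      simp only [hT', mem_filter, mem_product] at hx
      obtain ⟨⟨ha, hb⟩, hab, hlt⟩ := hx
      obtain ⟨-, hqr⟩ := hsum x.1 ha x.2 hb hab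
      rw [mem_filter, mem_Ico]
      exact ⟨⟨by omega, hlt⟩, hqr⟩
    have hcard : T'.card = (T'.image (fun x : ℕ × ℕ => x.1 + x.2)).card :=
      (card_image_of_injOn (hinj.mono (by exact_mod_cast hT'sub))).symm
    calc (T'.card : ℝ) = ((T'.image (fun x : ℕ × ℕ => x.1 + x.2)).card : ℝ) := by rw [hcard]
      _ ≤ (((Ico 1 L).filter (fun n : ℕ => legendreSym p n = 1)).card : ℝ) := by
          exact_mod_cast card_le_card himg
      _ = ∑ n ∈ (Ico 1 L).filter (fun n : ℕ => legendreSym p n = 1), (1 : ℝ) := by simp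
      _ = ∑ n ∈ (Ico 1 L).filter (fun n : ℕ => legendreSym p n = 1), ρ n := by
          refine sum_congr rfl fun n hn => ?_
          rw [mem_filter] at hn
          have hn' : n ∈ Ico 1 p := by
            rw [mem_Ico] at hn ⊢; exact ⟨hn.1.1, by omega⟩
          rw [hρone n hn' hn.2]
      _ ≤ ∑ n ∈ Ico 1 L, ρ n := by
          apply sum_le_sum_of_subset_of_nonneg (filter_subset _ _)
          intro n hn _
          have hn' : n ∈ Ico 1 p := by rw [mem_Ico] at hn ⊢; exact ⟨hn.1, by omega⟩
          exact (hρ01 n hn').1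
  -- the covered set P = sums of T, inside Ico L p, all QR
  set P := T.image (fun x : ℕ × ℕ => x.1 + x.2) with hP
  have hPcard : (P.card : ℝ) = T.card := by
    rw [hP, card_image_of_injOn (hinj.mono (by exact_mod_cast hTsub))]
  have hPsub : P ⊆ Ico L p := by
    intro n hn
    rw [hP, mem_image] at hn
    obtain ⟨x, hx, rfl⟩ := hn
    simp only [hT, mem_filter, mem_product] at hx
    obtain ⟨⟨ha, hb⟩, hab, hLx⟩ := hx
    exact mem_Ico.2 ⟨hLx, (hsum x.1 ha x.2 hb hab).1⟩
  have hPone : ∀ n ∈ P, ρ n = 1 := by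
    intro n hn
    have hn' := hPsub hn
    rw [hP, mem_image] at hn
    obtain ⟨x, hx, rfl⟩ := hn
    simp only [hT, mem_filter, mem_product] at hx
    obtain ⟨⟨ha, hb⟩, hab, -⟩ := hx
    exact hρone _ (by rw [mem_Ico] at hn' ⊢; exact ⟨by omega, hn'.2⟩) (hsum x.1 ha x.2 hb hab).2
  -- U := Σ_T 1/(a+b) = Σ_{n ∈ P} 1/n
  have hU : ∑ x ∈ T, (1 : ℝ) / ((x.1 : ℝ) + x.2) = ∑ n ∈ P, (1 : ℝ) / n := by
    rw [hP, sum_image (hinj.mono (by exact_mod_cast hTsub))]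
    refine sum_congr rfl fun x _ => ?_
    push_cast; ring
  -- (A) upper bound from the Sidon harmonic mass
  have hupper : ∑ x ∈ T, (1 : ℝ) / ((x.1 : ℝ) + x.2) ≤ 5 * Real.pi := by
    have h := sidonHarmonicMass Q q L hq1 h4q hws
    rw [← hT] at h
    refine h.trans ?_
    have hq0 : (0 : ℝ) < q := by exact_mod_cast hq1
    have hfac : 1 + 4 * (q : ℝ) / L ≤ 2 := by
      have : 4 * (q : ℝ) / L ≤ 1 := (div_le_one hL0).2 (by exact_mod_cast h4q)
      linarith
    have h5 : Real.pi / (2 * q) * (4 * q + (Q.card : ℝ)) = 5 * Real.pi / 2 := by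
      rw [← hq]; field_simp; ring
    calc Real.pi / (2 * q) * (4 * q + (Q.card : ℝ)) * (1 + 4 * (q : ℝ) / L)
        ≤ Real.pi / (2 * q) * (4 * q + (Q.card : ℝ)) * 2 := by
          apply mul_le_mul_of_nonneg_left hfac
          rw [h5]; positivity
      _ = 5 * Real.pi := by rw [h5]; ring
  -- (B) lower bound: Σ_{P} 1/n ≥ Σ_{Ico L p} ρ/n − (1/L)(Σ_{Ico L p} ρ − #P)
  have hlowerP : ∑ n ∈ Ico L p, ρ n / n - (∑ n ∈ Ico L p, ρ n - P.card) / L ≤ ∑ n ∈ P, (1 : ℝ) / n := by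
    have hsplit1 : ∑ n ∈ Ico L p, ρ n / n = ∑ n ∈ P, ρ n / n + ∑ n ∈ Ico L p \ P, ρ n / n :=
      (sum_sdiff hPsub).symm.trans (by ring)
    have hsplit2 : ∑ n ∈ Ico L p, ρ n = ∑ n ∈ P, ρ n + ∑ n ∈ Ico L p \ P, ρ n :=
      (sum_sdiff hPsub).symm.trans (by ring)
    have hP1 : ∑ n ∈ P, ρ n / n = ∑ n ∈ P, (1 : ℝ) / n := sum_congr rfl fun n hn => by rw [hPone n hn]
    have hP2 : ∑ n ∈ P, ρ n = P.card := by
      rw [card_eq_sum_ones]; push_cast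
      exact sum_congr rfl fun n hn => hPone n hn
    have hrest : ∑ n ∈ Ico L p \ P, ρ n / n ≤ (∑ n ∈ Ico L p \ P, ρ n) / L := by
      rw [sum_div]
      refine sum_le_sum fun n hn => ?_
      rw [mem_sdiff, mem_Ico] at hn
      have hn1 : n ∈ Ico 1 p := mem_Ico.2 ⟨by omega, hn.1.2⟩
      have hρ0 := (hρ01 n hn1).1
      have hLn : (L : ℝ) ≤ n := by exact_mod_cast hn.1.1
      exact div_le_div_of_nonneg_left hρ0 hL0 hLn
    rw [hsplit1, hsplit2, hP1, hP2]
    have : (↑P.card + ∑ n ∈ Ico L p \ P, ρ n - ↑P.card) / (L : ℝ) = (∑ n ∈ Ico L p \ P, ρ n) / L := by ring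
    rw [this]
    linarith
  -- (C) Σ_{Ico L p} ρ − #P ≤ (p−1)/2 + W/2 − q(q−1)/2
  have hdef : ∑ n ∈ Ico L p, ρ n - P.card ≤ ((p : ℝ) - 1) / 2 + W / 2 - (q : ℝ) * ((q : ℝ) - 1) / 2 := by
    -- total Σ_{Ico 1 p} ρ = (p-1)/2 + (1/2) Σ ℓ ≤ (p-1)/2 + W/2
    have htot : ∑ n ∈ Ico 1 p, ρ n ≤ ((p : ℝ) - 1) / 2 + W / 2 := by
      have h1 : ∑ n ∈ Ico 1 p, ρ n = ((p : ℝ) - 1) / 2 + (∑ n ∈ Ico 1 p, ℓ n) / 2 := by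
        have e : ∀ n, ρ n = 1 / 2 + ℓ n / 2 := fun n => by simp only [hρ]; ring
        rw [sum_congr rfl fun n _ => e n, sum_add_distrib, sum_const, Nat.card_Ico, nsmul_eq_mul,
          ← sum_div, Nat.cast_sub hp.one_lt.le]
        push_cast; ring
      have h2 : ∑ n ∈ Ico 1 p, ℓ n ≤ W := by
        have h3 := oc_abs_sum_legendreSym_Ioc_le p hp2 0 (p - 1)
        have hIco : Ico 1 p = Ioc 0 (p - 1) := by
          ext n; simp only [mem_Ico, mem_Ioc]; omega
        rw [hIco]
        exact (le_abs_self _).trans h3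
      rw [h1]; linarith
    have hsplitI : ∑ n ∈ Ico 1 p, ρ n = ∑ n ∈ Ico 1 L, ρ n + ∑ n ∈ Ico L p, ρ n :=
      (sum_Ico_consecutive ρ hL1 hLp).symm
    have hPT : (P.card : ℝ) = T₀.card - T'.card := by rw [hPcard, hTT']; ring
    have hT₀' : (T₀.card : ℝ) = ((q : ℝ) ^ 2 - q) / 2 := by linarith [hT₀card]
    have e : (q : ℝ) * ((q : ℝ) - 1) = (q : ℝ) ^ 2 - q := by ring
    rw [hPT, hT₀', e]
    linarith [htot, hsplitI, hT'le]
  -- (D) Σ_{Ico L p} ρ/n ≥ (1/2) log(p/L) − W/(2L)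
  have hmain : (1 / 2 : ℝ) * Real.log ((p : ℝ) / L) - W / (2 * L) ≤ ∑ n ∈ Ico L p, ρ n / n := by
    have h1 : ∑ n ∈ Ico L p, ρ n / n = (∑ n ∈ Ico L p, (1 : ℝ) / n) / 2 + (∑ n ∈ Ico L p, ℓ n / n) / 2 := by
      simp only [hρ]
      rw [sum_div, sum_div, ← sum_add_distrib]
      exact sum_congr rfl fun n _ => by ring
    have h2 := shm_log_div_le_sum_inv L p hL1 hLp
    have h3 : -(W / L) ≤ ∑ n ∈ Ico L p, ℓ n / n := by
      have h4 := oc_abs_sum_legendreSym_div_Ioc_le p hp2 (L - 1) (p - 1)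
      have hIco : Ico L p = Ioc (L - 1) (p - 1) := by
        ext n; simp only [mem_Ico, mem_Ioc]; omega
      have hcast : ((L - 1 : ℕ) : ℝ) + 1 = L := by
        rw [Nat.cast_sub hL1]; push_cast; ring
      rw [hcast] at h4
      rw [hIco]
      have := neg_abs_le (∑ n ∈ Ioc (L - 1) (p - 1), ℓ n / ↑n)
      simp only [hℓ] at this ⊢
      linarith
    rw [h1]
    have : W / (2 * L) = (W / L) / 2 := by field_simp
    rw [this]
    linarith
  -- assemble
  have hchain := hlowerP
  rw [← hU] at hchain
  have hdivmono : (∑ n ∈ Ico L p, ρ n - P.card) / L ≤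
      (((p : ℝ) - 1) / 2 + W / 2 - (q : ℝ) * ((q : ℝ) - 1) / 2) / L :=
    div_le_div_of_nonneg_right hdef hL0.le
  linarith [hmain, hchain, hupper, hdivmono]

end Summit.ValiantsHypothesis.ValiantsHypothesis.Theorems.CharPSparseSOSTwoCusp
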